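import Mathlib
import HarnessLib
import Summits.HubbardSuperconductivity.HubbardSuperconductivity.Theorems.KLProgrammeKLRegimeVolumeLimitBoundFinal

/-!
# Child `KLRegimeVolumeLimitV12` (stmt-HubbardSuperconductivity-19858) — the CUTOFF-FREE (`M = ∞`) VL carrier at fixed volume:
# definitions of the all-`U` limit objects (seat hubbard-kl-k3c5-p3 g4, technique «OS-positivity-free direct assembly»)

Both registered stubs of the VL skeleton «cauchy» (`stub_vl_bound`, `stub_vl_twoVolumeRate`) speak about the finite-cutoff carrier
`Σ̂^K_{L,M}(k,σ) = klSelfEnergy L M β U μ K klE0 (nScales β + 1) k σ` beyond a Matsubara threshold `Mth L` of the prover's choosing.  By the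
finite-`M` double Schwinger–Dyson form (`…VolumeLimitSchwingerDyson`: `Σ̂⁰ = U·occ_M + U²·βL²·b_M(k)/D_M`, the `ĝ⁻²` growth cancelled) and
the all-`U` Matsubara limits of the cell (t2 / k3c4-p2 pair-word machine), the carrier has a LABEL-UNIFORM `M → ∞` limit at every fixed
volume (`…VolumeLimitCutoffRemoval`).  This file NAMES the limit objects, so that the engine's volume statements can be made about them:

* `klDInf L β U μ` — `D∞ = e^{−βUL²/4}·Z_L(β;U,μ+U/2)/Z_L(β;0,μ)`, the limit of the bare normalised partition functions `∫dμ_{C_M}e^{−V_M(U)}`;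
* `klOccInf L β U μ` — `occ∞ = ⟨c†_{0↓}c_{0↓}⟩_{β,U,μ+U/2,L} − ½`, the limit of the (label-free) occupation ratio of the order-`U` term;
* `klSixWordInf L β U μ z u` — `S∞(z,u) = lim_M ∫dμ_{C_M} e^{−V_M}·sixPointWord L M β 0 1 z u` (the current–current word, `limUnder`);
* `klSixInf L β U μ n p` — `Six∞_L(n,p) = D∞⁻¹·∫₀^β Σ_z e^{−iω_n u} conj χ_p(z) S∞(z,u) du`, its Matsubara–Fourier coefficient at the INTEGER `n`;
* `klSelfEnergyInf L β U μ K n p` — `Σ∞^K_L(n,p) = (g₀/g_K)²(n,p)·(U·occ∞ + U²·Six∞_L(n,p)) + (g_K − g₀)/g_K²(n,p)` with the continuum frame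
  propagators `g_J = propInt β μ J n (latticeMomentum L p)` — the cutoff-free proxy of `Σ̂^K_{L,M}((ω,p),σ)` at `n = matsubaraInt M ω` (spin-free:
  the carrier is spin independent, `klSelfEnergy_nScales_succ_spin_eq`).

Plus the basic facts: `klDInf ≠ 0` and `D_M → klDInf`; `S_M(z,u) → S∞(z,u)` on `[0,β)` with an `M`-eventual sup bound on `[0,β]`; `occ_M → occ∞`,
`‖occ∞‖ ≤ 3/2`; the bare-frame form of `Σ∞`.  Definitions + their immediate API only.
-/

noncomputable section

namespace Summit.HubbardSuperconductivity.HubbardSuperconductivity.Theorems.TwoPointAssembly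

set_option linter.dupNamespace false -- summit = problem name (single-conjunct summit), D-0017

open Finset Filter Topology MeasureTheory intervalIntegral Literature.MathematicalPhysics.QuantumLattice Literature.Probability.LatticeModels
  GrassmannAlgebra
open scoped ComplexConjugate ComplexOrder

section Defs

variable (L : ℕ) [NeZero L]

/-- `D∞ = e^{−βUL²/4}·Z_L(β;U,μ+U/2)/Z_L(β;0,μ)`: the all-`U` Matsubara limit of the bare normalised partition functions
`∫dμ_{C_M} e^{−V_M(U)}` (t2's `tendsto_effPartitionFn_hubbard_eq_partitionFn_div_allU`). -/
def klDInf (β U μ : ℝ) : ℂ :=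
  ((Real.exp (-(β * U / 4 * (L : ℝ) ^ 2)) : ℝ) : ℂ) * Matrix.partitionFn β (hubbardTorusWith 2 L 1 U (μ + U / 2)) /
    Matrix.partitionFn β (hubbardTorusWith 2 L 1 0 μ)

/-- `occ∞ = ⟨c†_{0↓}c_{0↓}⟩_{β,U,μ+U/2,L} − ½`: the all-`U` Matsubara limit of the occupation ratio `(βL²)⁻²Σ_q N_M(q,↓)/D_M` carried by the
order-`U` term of the bare spin-`↑` carrier (`tendsto_occupationRatio_allU`). -/
def klOccInf (β U μ : ℝ) : ℂ :=
  hubbardThermalTwoPoint β U (μ + U / 2) L 0 0 1 1 - 1 / 2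

/-- `S∞(z,u) = lim_{M→∞} ∫dμ_{C_M} e^{−V_M(U)}·sixPointWord L M β 0 1 z u`: the all-`U` Matsubara limit of the word six-point numerator
(the pair-word machine `tendsto_gaussExpect_word_mul_grassmannExp_allU`; `limUnder`, identified on `u ∈ [0,β)` by `tendsto_klSixWordInf`). -/
def klSixWordInf (β U μ : ℝ) (z : TorusSite 2 L) (u : ℝ) : ℂ :=
  limUnder atTop fun M : ℕ =>
    gaussExpect ℂ (hubbardCovariance L M β μ 0) (grassmannExp (-(hubbardInteraction L M β U)) * sixPointWord L M β 0 1 z u)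

/-- `Six∞_L(n,p) = D∞⁻¹·∫₀^β Σ_z e^{−iω_n u} conj χ_p(z) S∞(z,u) du`, `ω_n = π(2n+1)/β`: the cutoff-free six-point Matsubara coefficient at the
INTEGER label `n` and torus momentum `p`. -/
def klSixInf (β U μ : ℝ) (n : ℤ) (p : TorusSite 2 L) : ℂ :=
  (∫ u in (0 : ℝ)..β, ∑ z : TorusSite 2 L,
      Complex.exp (-(((Real.pi * (2 * (n : ℝ) + 1) / β * u : ℝ) : ℂ) * Complex.I)) * conj (torusChar p z) * klSixWordInf L β U μ z u) /
    klDInf L β U μ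

/-- `Σ∞^K_L(n,p) = (g₀/g_K)²·(U·occ∞ + U²·Six∞_L(n,p)) + (g_K − g₀)/g_K²`, `g_J = propInt β μ J n (latticeMomentum L p)`: the cutoff-free VL
carrier in the frame `K` (the `M = ∞` form of `klSelfEnergy_nScales_succ_eq_schwingerDyson`). -/
def klSelfEnergyInf (β U μ : ℝ) (K : TrigPolyC4v) (n : ℤ) (p : TorusSite 2 L) : ℂ :=
  (propInt β μ 0 n (latticeMomentum L p) / propInt β μ K n (latticeMomentum L p)) ^ 2 *
      ((U : ℂ) * klOccInf L β U μ + (U : ℂ) ^ 2 * klSixInf L β U μ n p) +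
    (propInt β μ K n (latticeMomentum L p) - propInt β μ 0 n (latticeMomentum L p)) / propInt β μ K n (latticeMomentum L p) ^ 2

end Defs

variable {L : ℕ} [NeZero L]

/-! ## The partition-function limit -/

omit [NeZero L] in
/-- `D∞ ≠ 0`. -/
theorem klDInf_ne_zero (β U μ : ℝ) : klDInf L β U μ ≠ 0 := by
  haveI : Nonempty (Finset (Orb (FermionTorus 2 L))) := ⟨∅⟩
  have hZ' : Matrix.partitionFn β (hubbardTorusWith 2 L 1 U (μ + U / 2)) ≠ 0 :=
    (Matrix.partitionFn_pos β (isHermitian_hamiltonianWith (fermionTorusGraph 2 L) 1 U (μ + U / 2))).ne'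
  have hZ₀ : Matrix.partitionFn β (hubbardTorusWith 2 L 1 0 μ) ≠ 0 :=
    (Matrix.partitionFn_pos β (isHermitian_hamiltonianWith (fermionTorusGraph 2 L) 1 0 μ)).ne'
  have he : ((Real.exp (-(β * U / 4 * (L : ℝ) ^ 2)) : ℝ) : ℂ) ≠ 0 := by exact_mod_cast (Real.exp_pos _).ne'
  exact div_ne_zero (mul_ne_zero he hZ') hZ₀

/-- `D_M → D∞` (every `U`; `L ≥ 3`, `β > 0`). -/
theorem tendsto_effPartitionFn_klDInf (hL : 3 ≤ L) {β : ℝ} (hβ : 0 < β) (U μ : ℝ) :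
    Tendsto (fun M : ℕ => effPartitionFn ℂ (hubbardCovariance L M β μ 0) (hubbardInteraction L M β U)) atTop (𝓝 (klDInf L β U μ)) :=
  MatsubaraAllU.tendsto_effPartitionFn_hubbard_eq_partitionFn_div_allU hL hβ μ U

/-! ## The six-point word limit -/

/-- **`S_M(z,u) → S∞(z,u)` for `u ∈ [0,β)`** (every `U`, `β > 0`). -/
theorem tendsto_klSixWordInf {β : ℝ} (hβ : 0 < β) (U μ : ℝ) (z : TorusSite 2 L) {u : ℝ} (hu : u ∈ Set.Ico (0 : ℝ) β) :
    Tendsto (fun M : ℕ =>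
      gaussExpect ℂ (hubbardCovariance L M β μ 0) (grassmannExp (-(hubbardInteraction L M β U)) * sixPointWord L M β 0 1 z u))
      atTop (𝓝 (klSixWordInf L β U μ z u)) := by
  obtain ⟨hPe, hQe⟩ := sixPair_injective
  have h := MatsubaraAllU.tendsto_gaussExpect_word_mul_grassmannExp_allU (L := L) hβ μ U (![z, 0]) (timePair_mem_Ico hβ hu) _ _ hPe hQe
  exact tendsto_nhds_limUnder ⟨_, h.congr fun M => congrArg _ (boltzmann_mul_sixPointWord_eq_word (M := M) β U z u).symm⟩

/-- **An `M`-eventual sup bound of `S_M(z,u)` on `[0,β]`, uniform in the torus site** (every `U`, `β > 0`). -/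
theorem exists_eventually_norm_sixWord_le {β : ℝ} (hβ : 0 < β) (U μ : ℝ) :
    ∃ C : ℝ, 0 ≤ C ∧ ∀ᶠ M : ℕ in atTop, ∀ (z : TorusSite 2 L), ∀ u ∈ Set.Icc (0 : ℝ) β,
      ‖gaussExpect ℂ (hubbardCovariance L M β μ 0) (grassmannExp (-(hubbardInteraction L M β U)) * sixPointWord L M β 0 1 z u)‖ ≤ C := by
  obtain ⟨hPe, hQe⟩ := sixPair_injective
  have hb : ∀ z : TorusSite 2 L, ∃ C : ℝ, 0 ≤ C ∧ ∃ M₀ : ℕ, ∀ M, M₀ ≤ M → ∀ u ∈ Set.Icc (0 : ℝ) β,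
      ‖gaussExpect ℂ (hubbardCovariance L M β μ 0) (grassmannExp (-(hubbardInteraction L M β U)) * sixPointWord L M β 0 1 z u)‖ ≤ C := by
    intro z
    obtain ⟨C, hC0, M₀, hM₀⟩ := MatsubaraAllU.exists_uniform_bound_gaussExpect_word_allU (L := L) hβ μ U (![z, 0]) _ _ hPe hQe
    refine ⟨C, hC0, M₀, fun M hM u hu => ?_⟩
    rw [boltzmann_mul_sixPointWord_eq_word]
    exact hM₀ M hM _ (timePair_mem_Icc hβ hu)
  choose Cz hCz0 M₀ hM₀ using hb
  refine ⟨∑ z : TorusSite 2 L, Cz z, Finset.sum_nonneg fun z _ => hCz0 z, ?_⟩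
  filter_upwards [Filter.eventually_all.2 fun z => eventually_ge_atTop (M₀ z)] with M hM z u hu
  exact (hM₀ z M (hM z) u hu).trans (Finset.single_le_sum (fun z _ => hCz0 z) (Finset.mem_univ z))

/-- **`L¹([0,β])` convergence of the word six-point function and integrability of its limit** (every `U`, `β > 0`): for every torus site,
`u ↦ S∞(z,u)` is interval-integrable on `[0,β]` and `∫₀^β ‖S_M(z,u) − S∞(z,u)‖ du → 0`. -/
theorem klSixWordInf_integrable_and_l1 {β : ℝ} (hβ : 0 < β) (U μ : ℝ) (z : TorusSite 2 L) :
    IntervalIntegrable (klSixWordInf L β U μ z) volume 0 β ∧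
      Tendsto (fun M : ℕ => ∫ u in (0 : ℝ)..β,
        ‖gaussExpect ℂ (hubbardCovariance L M β μ 0) (grassmannExp (-(hubbardInteraction L M β U)) * sixPointWord L M β 0 1 z u) -
          klSixWordInf L β U μ z u‖) atTop (𝓝 0) := by
  obtain ⟨C, -, hbd⟩ := exists_eventually_norm_sixWord_le (L := L) hβ U μ
  exact l1_tendsto_of_pointwise_dominated hβ
    (fun M u => gaussExpect ℂ (hubbardCovariance L M β μ 0) (grassmannExp (-(hubbardInteraction L M β U)) * sixPointWord L M β 0 1 z u))
    (klSixWordInf L β U μ z) (fun M => continuous_wordSixPoint_up (L := L) (M := M) β U μ z)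
    (fun u hu => tendsto_klSixWordInf hβ U μ z hu) (hbd.mono fun M hM => hM z)

/-! ## The occupation limit -/

/-- **`occ_M → occ∞`**: the occupation ratio of the order-`U` term of the bare spin-`↑` carrier converges for every `U` (`L ≥ 3`, `β > 0`). -/
theorem tendsto_occupationRatio_klOccInf (hL : 3 ≤ L) {β : ℝ} (hβ : 0 < β) (U μ : ℝ) :
    Tendsto (fun M : ℕ =>
        (((1 / (β * (L : ℝ) ^ 2) ^ 2 : ℝ) : ℂ)) *
            (∑ q : FreqMomentum L M,
              gaussExpect ℂ (hubbardCovariance L M β μ 0)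
                (gen ℂ (((q, (1 : Fin 2)), 0) : HubbardFieldIdx L M) * gen ℂ (((q, (1 : Fin 2)), 1) : HubbardFieldIdx L M) *
                  grassmannExp (-(hubbardInteraction L M β U)))) /
          effPartitionFn ℂ (hubbardCovariance L M β μ 0) (hubbardInteraction L M β U))
      atTop (𝓝 (klOccInf L β U μ)) :=
  tendsto_occupationRatio_allU hL hβ μ U 1 0

omit [NeZero L] in
/-- `‖occ∞‖ ≤ 3/2`, uniformly in the volume. -/
theorem norm_klOccInf_le (β U μ : ℝ) : ‖klOccInf L β U μ‖ ≤ 3 / 2 :=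
  norm_occupationLimit_le β U μ L 1 0

/-! ## The cutoff-free carrier: bare frame, and the frame dressing -/

/-- In the bare frame `Σ∞⁰_L(n,p) = U·occ∞ + U²·Six∞_L(n,p)` (`β ≠ 0`). -/
theorem klSelfEnergyInf_zero_frame {β : ℝ} (hβ : β ≠ 0) (U μ : ℝ) (n : ℤ) (p : TorusSite 2 L) :
    klSelfEnergyInf L β U μ 0 n p = (U : ℂ) * klOccInf L β U μ + (U : ℂ) ^ 2 * klSixInf L β U μ n p := by
  have hg : propInt β μ 0 n (latticeMomentum L p) ≠ 0 := one_div_ne_zero (propInt_den_ne_zero hβ μ 0 n _)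
  rw [klSelfEnergyInf, div_self hg, one_pow, one_mul, sub_self, zero_div, add_zero]

/-- **Every frame from the bare one**: `Σ∞^K_L(n,p) = (g₀/g_K)²·Σ∞⁰_L(n,p) + (g_K − g₀)/g_K²` (`β ≠ 0`) — the cutoff-free form of
`klSelfEnergy_nScales_succ_eq_schwingerDyson`. -/
theorem klSelfEnergyInf_eq_dressing {β : ℝ} (hβ : β ≠ 0) (U μ : ℝ) (K : TrigPolyC4v) (n : ℤ) (p : TorusSite 2 L) :
    klSelfEnergyInf L β U μ K n p =
      (propInt β μ 0 n (latticeMomentum L p) / propInt β μ K n (latticeMomentum L p)) ^ 2 * klSelfEnergyInf L β U μ 0 n p +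
        (propInt β μ K n (latticeMomentum L p) - propInt β μ 0 n (latticeMomentum L p)) / propInt β μ K n (latticeMomentum L p) ^ 2 := by
  rw [klSelfEnergyInf_zero_frame hβ, klSelfEnergyInf]

/-- **The frame dressing is bounded uniformly in the label and the volume**: `‖g₀/g_K‖ ≤ 1 + ‖K‖₀·β/π` (`β > 0`; `‖K‖₀ = K.coeffNorm 0`). -/
theorem norm_propInt_div_propInt_le {β : ℝ} (hβ : 0 < β) (μ : ℝ) (K : TrigPolyC4v) (n : ℤ) (q : Fin 2 → ℝ) :
    ‖propInt β μ 0 n q / propInt β μ K n q‖ ≤ 1 + K.coeffNorm 0 * (β / Real.pi) := by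
  have hD0 := propInt_den_ne_zero hβ.ne' μ 0 n q
  have hDK := propInt_den_ne_zero hβ.ne' μ K n q
  have hq : propInt β μ 0 n q / propInt β μ K n q =
      (-Complex.I * (freqOfInt β n : ℂ) + (bandCT μ K q : ℂ)) / (-Complex.I * (freqOfInt β n : ℂ) + (bandCT μ 0 q : ℂ)) := by
    rw [propInt, propInt]; field_simp
  have hω : Real.pi / β ≤ |freqOfInt β n| := by
    rw [freqOfInt, abs_div, abs_of_pos hβ, abs_mul, abs_of_pos Real.pi_pos]
    exact div_le_div_of_nonneg_right (le_mul_of_one_le_right Real.pi_pos.le (one_le_abs_two_mul_add_one n)) hβ.le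
  rw [hq]
  refine (norm_shift_ratio_le hβ _ hω _ _).trans ?_
  have hdiff : |bandCT μ K q - bandCT μ 0 q| ≤ K.coeffNorm 0 := by
    have h : bandCT μ K q - bandCT μ 0 q = -K.eval q := by simp only [bandCT, TrigPolyC4v.eval_zero]; ring
    rw [h, abs_neg]
    exact TrigPolyC4v.abs_eval_le_coeffNorm K q
  have hK0 : 0 ≤ β / Real.pi := div_nonneg hβ.le Real.pi_pos.le
  calc 1 + |bandCT μ K q - bandCT μ 0 q| * (β / Real.pi) ≤ 1 + K.coeffNorm 0 * (β / Real.pi) := by gcongr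

end Summit.HubbardSuperconductivity.HubbardSuperconductivity.Theorems.TwoPointAssembly

end
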